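import Summits.Ventures.Crystal3D.Theorems.StickyWulffConstantCoaxialWallLawWordEnds
import HarnessLib

/-!
# Sources ≤ REACHABLE ends + REACHABLE exits: the orbit-restricted count for the word automaton

HONEST FRAMING. Part of the venture `Summits/Ventures/Crystal3D` (cell `crystal3d-full`), helper for the crux
`CoaxialWallLaw` (stmt-Ventures-19481) of `route-Ventures-StickyWulffConstant`, REGISTERED line `WallLedgerF`
(planner cf-p1 gen 16), open stub `stub_coaxialTwoSlabAdhesion` (general fillings).  A refinement of 19481-p2's
counting brick `card_sources_le_ends_add_exits` (`…CoaxialWallLawWordEnds`, v2 NET line automaton): the ends and the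
exits that bound the sources may be restricted to states REACHABLE from the sources, hence to states satisfying any
predicate `P` that holds on the first images of the sources and is preserved by moves inside the window.  Purpose
(memo F-FRONTIER-g5 §4(a′), evidence on the crux item): with the automaton ROOTED AT AN IN-PLANE SLOT of grain 1
(`⟪A₁ w, L e₃⟫ = 0`), the invariant «the bottom letter of the word is not the lamination normal» holds along every
orbit of a source, so for a twin pair no reachable state has the class of `Λ₂` and the TOP-BAND term of
`word_sources_le` disappears (no capacity subtraction, no regime restriction).  Pure finite combinatorics; no geometry.
Rung credit only; F-C1 not moved.

* `card_sources_le_ends_add_exits_of_invariant` — `V, S` finite, `f` injective on the moving states of `V ∪ S`,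
  `S` disjoint from `V`, every source moving with `f s ∈ V`; `P (f s)` for every source and
  `P v → P (f v)` along moves that stay in `V`.  Then
  `#S ≤ #{v ∈ V | ¬mov v ∧ P v} + #{v ∈ V | mov v ∧ f v ∉ V ∧ P v}`.
  (Proof: apply the unrestricted count to the forward closure `R ⊆ V` of `f '' S`; an `R`-state whose image
  leaves `R` leaves `V`, by closure; `P` holds on `R` by induction along `Relation.ReflTransGen`.)

WHAT THIS IS NOT: not the stub; the in-plane-rooted instantiation is not in this file; F-C1 not moved.
-/

namespace Summit.Ventures.Crystal3D.Theorems

open Finset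

open scoped Classical in
/-- **Sources ≤ reachable ends + reachable exits.**  See the module docstring. -/
theorem card_sources_le_ends_add_exits_of_invariant {α : Type*} [DecidableEq α] (V S : Finset α) (f : α → α)
    (mov : α → Prop) [DecidablePred mov] (P : α → Prop)
    (hinj : Set.InjOn f {v | (v ∈ V ∨ v ∈ S) ∧ mov v})
    (hdisj : Disjoint S V) (hS : ∀ s ∈ S, mov s ∧ f s ∈ V)
    (hPS : ∀ s ∈ S, P (f s)) (hPstep : ∀ v ∈ V, mov v → f v ∈ V → P v → P (f v)) :
    S.card ≤ (V.filter fun v => ¬ mov v ∧ P v).card +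
      (V.filter fun v => mov v ∧ f v ∉ V ∧ P v).card := by
  -- one move inside the window
  set step : α → α → Prop := fun u v => u ∈ V ∧ mov u ∧ f u = v ∧ v ∈ V with hstep
  -- the forward closure of the first images of the sources
  set R : Finset α := V.filter fun v => ∃ s ∈ S, Relation.ReflTransGen step (f s) v with hR
  have hRV : R ⊆ V := filter_subset _ _
  have hSR : ∀ s ∈ S, f s ∈ R := fun s hs =>
    mem_filter.2 ⟨(hS s hs).2, s, hs, Relation.ReflTransGen.refl⟩
  have hclosed : ∀ v ∈ R, mov v → f v ∈ V → f v ∈ R := by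
    intro v hv hm hfv
    obtain ⟨hvV, s, hs, hsv⟩ := mem_filter.1 hv
    exact mem_filter.2 ⟨hfv, s, hs, hsv.tail ⟨hvV, hm, rfl, hfv⟩⟩
  -- the invariant along the closure
  have hPpath : ∀ s ∈ S, ∀ v, Relation.ReflTransGen step (f s) v → P v := by
    intro s hs v hsv
    induction hsv with
    | refl => exact hPS s hs
    | tail _ hbc ih =>
        obtain ⟨hbV, hbm, hfb, hcV⟩ := hbc
        rw [← hfb]
        exact hPstep _ hbV hbm (hfb ▸ hcV) ih
  have hPR : ∀ v ∈ R, P v := by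
    intro v hv
    obtain ⟨-, s, hs, hsv⟩ := mem_filter.1 hv
    exact hPpath s hs v hsv
  -- the unrestricted count on `R`
  have hinjR : Set.InjOn f {v | (v ∈ R ∨ v ∈ S) ∧ mov v} := by
    intro x hx y hy hxy
    refine hinj ⟨?_, hx.2⟩ ⟨?_, hy.2⟩ hxy
    · exact hx.1.imp_left fun h => hRV h
    · exact hy.1.imp_left fun h => hRV h
  have hdisjR : Disjoint S R := Finset.disjoint_of_subset_right hRV hdisj
  have hSR' : ∀ s ∈ S, mov s ∧ f s ∈ R := fun s hs => ⟨(hS s hs).1, hSR s hs⟩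
  have hcount := card_sources_le_ends_add_exits R S f mov hinjR hdisjR hSR'
  -- compare the two right-hand sides
  have h1 : (R.filter fun v => ¬ mov v) ⊆ V.filter fun v => ¬ mov v ∧ P v := by
    intro v hv
    obtain ⟨hvR, hm⟩ := mem_filter.1 hv
    exact mem_filter.2 ⟨hRV hvR, hm, hPR v hvR⟩
  have h2 : ((R.filter fun v => mov v).filter fun v => f v ∉ R) ⊆ V.filter fun v => mov v ∧ f v ∉ V ∧ P v := by
    intro v hv
    obtain ⟨hv1, hfR⟩ := mem_filter.1 hv
    obtain ⟨hvR, hm⟩ := mem_filter.1 hv1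
    refine mem_filter.2 ⟨hRV hvR, hm, fun hfV => hfR (hclosed v hvR hm hfV), hPR v hvR⟩
  have h1c := card_le_card h1
  have h2c := card_le_card h2
  omega

end Summit.Ventures.Crystal3D.Theorems
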